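import Summits.NavierStokesRegularity.NavierStokesRegularity.Theses.AxisymmetricExtremality
import Literature.Analysis.FluidPDE.KNSSNoAxisymmetricTypeIHolds
import Literature.Analysis.FluidPDE.NSBoundedHigherRegularity
import Literature.Analysis.FluidPDE.SereginSverakOffAxisRegularity
import Literature.Analysis.FluidPDE.AxisymmetricSingularSetOnAxis
import Literature.Analysis.FluidPDE.SuitableWeakCongr
import Literature.Analysis.FluidPDE.LocalTypeI
import HarnessLib

/-!
# Seregin 2020, proof of Thm 2.1: off the axis, an axisymmetric suitable weak solution is a
# "sufficiently smooth axially symmetric solution" (the Seregin–Zajaczkowski 2007 class)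

Helper toward the stub `stub_seregin2020TypeII` of the crux `AxisymmetricKatoGlobal` (= the named
fact `Literature.Analysis.FluidPDE.Seregin2020_axisymmetricSingularPoint_typeII`, G. Seregin,
Anal. Math. Phys. 10 (2020) Paper 46 = arXiv:2006.04140, Thm 2.1). The printed proof (arXiv
pp. 4–5) runs the swirl equation (2.2) and the Moser iteration (2.3)–(2.6) in
`Q ∖ ({x' = 0} × ]-1, 0[)`, using: "Denote by `S` the set of singular points of `v`. It is well
known that … `x' = 0` for any `z = (x, t) ∈ S`, and any spatial derivative of `v` is Hölder
continuous in `𝒞 × ]-1, 0] ∖ S`." The tree proves (2.2)–(2.4) for the hypothesis class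
`SereginZajaczkowski2007.IsSmoothAxisymmetricSolutionOn S V P` on an arbitrary open, rotation
invariant, off-axis product region `S = ]lo, hi[ × U` (`Seregin2020SwirlEquationOffAxis.lean`,
`Seregin2020SwirlEnergyInequality.lean`, `Seregin2020SwirlMoserEnergyBound.lean`), and it proves
the two quoted ingredients — off-axis points of an axisymmetric suitable weak solution are
regular (`isRegularPoint_of_cylRadius_ne_zero`, CKN) and essentially bounded distributional
solutions have smooth representatives with Hölder continuous spatial derivatives
(`NSBoundedHigherRegularity_holds`, glued on open sets by
`NSBoundedHigherRegularity.exists_smooth_representative`) — but the passage "axisymmetric suitable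
weak solution ⇒ member of that class off the axis" was not recorded. This file records it:

* `exists_nhds_ae_norm_le_of_isRegularPoint` — a regular point has a neighbourhood on which the
  field is essentially bounded (unfolding of `IsRegularPoint`);
* `exists_isSmoothAxisymmetricSolutionOn_of_offAxis` — GENERIC form: `(u, p)` suitable on an open
  `Q` with axisymmetric slices at the times of `Q`, `S ≤ Q` open, off the axis and invariant
  under `(t, x) ↦ (t, R_θ x)` ⟹ `u` has a representative `V` on `S` with `(V, p)` in the class on
  `S` (regular points ⟹ locally bounded ⟹ one smooth representative on `S`; suitability transported
  by `IsSuitableWeakSolutionOn.congr_ae`; pointwise symmetry of the continuous representative by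
  `SereginSverak2009.isAxisymmetricOn_of_ae_eq`);
* `exists_isSmoothAxisymmetricSolutionOn_offAxis` — the form for the hypotheses (H) of Thm 2.1
  (unit cylinder `Q = 𝒞 × ]-1, 0[`, regions `]lo, hi[ × U`, `-1 ≤ lo`, `hi ≤ 0`, `U ⊆ 𝒞` open,
  off the axis, rotation invariant);
* `exists_isSmoothAxisymmetricSolutionOn_offAxis_of_inBall` — the form for the blow-up limit
  (property (𝒜): suitable in Albritton–Barker's class on `Q(a)`, every slice axisymmetric);
* `stub_seregin2020TypeII_offAxisRepr` — the registered sub-stub (the three statements conjoined).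

## References

* G. Seregin, Anal. Math. Phys. 10 (2020), Paper 46 = arXiv:2006.04140, proof of Thm. 2.1
  (structure of the singular set and smoothness off the axis, arXiv p. 5). [Seregin2020]
* G. Seregin, W. Zajaczkowski, SIAM J. Math. Anal. 39 (2007) 669–685, §3 ("all spatial
  derivatives of `u` are Hölder continuous in a vicinity of each point with `y' ≠ 0`").
  [SereginZajaczkowski2007]
* L. Caffarelli, R. Kohn, L. Nirenberg, CPAM 35 (1982), §6. [CaffarelliKohnNirenberg1982]
-/

-- the problem directory repeats the summit name (D-0017); core's `dupNamespace` linter fires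
set_option linter.dupNamespace false

noncomputable section

open MeasureTheory Set Function Filter Topology TopologicalSpace Metric
open scoped NNReal ENNReal

namespace Summit.NavierStokesRegularity.NavierStokesRegularity.Theorems.AxisymmetricKatoGlobal.EulerScaling

open Literature.Analysis.FluidPDE Literature.Analysis.FluidPDE.SereginZajaczkowski2007
  Literature.Analysis.FluidPDE.SereginSverak2009

/-! ### Regular points are points of local essential boundedness -/

/-- A regular point `z` of `u` (`u ∈ L^∞(Q*_r(z))` for some `r > 0`) has a neighbourhood on which
`‖u‖ ≤ M` almost everywhere (`M` the essential supremum over the centred cylinder). [folklore] -/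
theorem exists_nhds_ae_norm_le_of_isRegularPoint
    {u : ℝ → EuclideanSpace ℝ (Fin 3) → EuclideanSpace ℝ (Fin 3)} {z : ℝ × EuclideanSpace ℝ (Fin 3)}
    (hreg : IsRegularPoint u z) :
    ∃ N ∈ 𝓝 z, ∃ M : ℝ, ∀ᵐ w ∂(volume.restrict N), ‖u w.1 w.2‖ ≤ M := by
  obtain ⟨r, hr, hfin⟩ := hreg
  refine ⟨parabolicCylinderCentered r z, (isOpen_parabolicCylinderCentered r z).mem_nhds ?_,
    (eLpNorm (uncurry u) ∞ (volume.restrict (parabolicCylinderCentered r z))).toReal, ?_⟩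
  · rw [mem_parabolicCylinderCentered, dist_self]
    have hr2 : 0 < r ^ 2 := by positivity
    exact ⟨⟨by linarith, by linarith⟩, hr⟩
  · filter_upwards [ae_le_eLpNormEssSup (f := uncurry u)
      (μ := volume.restrict (parabolicCylinderCentered r z))] with w hw
    rw [← eLpNorm_exponent_top] at hw
    calc ‖u w.1 w.2‖ = ‖uncurry u w‖ₑ.toReal := (toReal_enorm _).symm
      _ ≤ (eLpNorm (uncurry u) ∞ (volume.restrict (parabolicCylinderCentered r z))).toReal :=
        ENNReal.toReal_mono hfin.ne hw

/-! ### The generic off-axis representative -/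

/-- **Off the axis, an axisymmetric suitable weak solution is a "sufficiently smooth axially
symmetric solution"** (Seregin 2020, proof of Thm 2.1, arXiv p. 5; Seregin–Zajaczkowski 2007,
§3). Let `(u, p)` be a suitable weak solution of the unforced Navier–Stokes system (`ν = 1`) on an
open `Q ⊆ ℝ × ℝ³` whose slices `u t` are axisymmetric at the times of `Q`, and let `S ⊆ Q` be
open, off the axis (`|x'| ≠ 0` on `S`) and invariant under the rotations `(t, x) ↦ (t, R_θ x)`.
Then `u` has a representative `V` on `S` (`u = V` a.e. on `S`) such that `(V, p)` belongs on `S`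
to the hypothesis class `SereginZajaczkowski2007.IsSmoothAxisymmetricSolutionOn` (suitable on `S`,
axisymmetric at every point of `S`, every slice `C^∞` at the points of `S`, all spatial
derivatives locally Hölder continuous in space–time). Proof: every point of `S` is a regular
point (`isRegularPoint_of_cylRadius_ne_zero`, CKN), hence `u` is locally essentially bounded on
`S` and `p ∈ L^{3/2}_{loc}(Q)`; `NSBoundedHigherRegularity_holds.exists_smooth_representative`
gives one smooth representative on `S`; suitability is transported along the a.e. equality and
the symmetry of the continuous representative holds pointwise
(`SereginSverak2009.isAxisymmetricOn_of_ae_eq`).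
[cite: Seregin2020, proof of Thm 2.1] -/
theorem exists_isSmoothAxisymmetricSolutionOn_of_offAxis
    {Q S : Opens (ℝ × EuclideanSpace ℝ (Fin 3))}
    {u : ℝ → EuclideanSpace ℝ (Fin 3) → EuclideanSpace ℝ (Fin 3)}
    {p : ℝ → EuclideanSpace ℝ (Fin 3) → ℝ}
    (hsw : IsSuitableWeakSolutionOn Q 1 0 u p)
    (hax : ∀ z ∈ (Q : Set (ℝ × EuclideanSpace ℝ (Fin 3))), IsAxisymmetric (u z.1))
    (hSQ : S ≤ Q)
    (hSax : ∀ z ∈ (S : Set (ℝ × EuclideanSpace ℝ (Fin 3))), cylRadius z.2 ≠ 0)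
    (hSrot : ∀ θ : ℝ, ∀ z ∈ (S : Set (ℝ × EuclideanSpace ℝ (Fin 3))),
      ((z.1, rotZ θ z.2) : ℝ × EuclideanSpace ℝ (Fin 3)) ∈ (S : Set (ℝ × EuclideanSpace ℝ (Fin 3)))) :
    ∃ V : ℝ → EuclideanSpace ℝ (Fin 3) → EuclideanSpace ℝ (Fin 3),
      IsSmoothAxisymmetricSolutionOn S V p ∧
        uncurry u =ᵐ[volume.restrict (S : Set (ℝ × EuclideanSpace ℝ (Fin 3)))] uncurry V := by
  have hSo : IsOpen (S : Set (ℝ × EuclideanSpace ℝ (Fin 3))) := S.isOpen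
  -- the equations on `S`
  have hsol : IsDistributionalNSSolutionOn S 1 0 u p := hsw.distributional.of_le hSQ
  -- every point of `S` is regular, hence `u` is locally essentially bounded on `S`
  have hbd : ∀ z ∈ (S : Set (ℝ × EuclideanSpace ℝ (Fin 3))), ∃ N ∈ 𝓝 z, ∃ M : ℝ,
      ∀ᵐ w ∂(volume.restrict N), ‖u w.1 w.2‖ ≤ M := fun z hz =>
    exists_nhds_ae_norm_le_of_isRegularPoint
      (isRegularPoint_of_cylRadius_ne_zero one_pos hsw (isCKNForceOn_zero Q) hax (hSQ hz)
        (hSax z hz))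
  -- `p ∈ L^{3/2}` near every point (compact neighbourhoods inside `Q`)
  have hp : ∀ z ∈ (S : Set (ℝ × EuclideanSpace ℝ (Fin 3))), ∃ N ∈ 𝓝 z,
      ∫⁻ w in N, ‖p w.1 w.2‖ₑ ^ (3 / 2 : ℝ) < ∞ := by
    intro z hz
    obtain ⟨K, hKc, hzK, hKQ⟩ := exists_compact_subset Q.isOpen (hSQ hz)
    exact ⟨K, mem_interior_iff_mem_nhds.1 hzK, hsw.pressure K hKQ hKc⟩
  -- one smooth representative on `S`
  obtain ⟨V, hae, hVc, hCD, hHol⟩ :=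
    NSBoundedHigherRegularity_holds.exists_smooth_representative hsol hbd hp
  have hsuit : IsSuitableWeakSolutionOn S 1 0 V p :=
    (hsw.of_le hSQ).congr_ae hae (Eventually.of_forall fun _ => rfl)
  have haxi : IsAxisymmetricOn (S : Set (ℝ × EuclideanSpace ℝ (Fin 3))) V :=
    isAxisymmetricOn_of_ae_eq hSo hSrot (fun z hz θ => hax z (hSQ hz) θ z.2) hVc hae
  refine ⟨V, ⟨hsuit, haxi, hCD, fun n z hz => ?_⟩, hae⟩
  obtain ⟨N, hNo, hzN, -, C, α, hα, hHN⟩ := hHol n z hz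
  exact ⟨N, hNo.mem_nhds hzN, C, α, hα, hHN.mono inter_subset_left⟩

/-! ### The form for the hypotheses of Theorem 2.1 -/

/-- **Seregin 2020, proof of Thm 2.1: the off-axis smooth representative for the class (H) of
Theorem 2.1.** For a suitable weak solution `(v, q)` in the unit cylinder `Q = 𝒞 × ]-1, 0[` with
the global classes of Def. 1.3 and axisymmetric slices, and for every open, rotation invariant,
off-axis product region `S = ]lo, hi[ × U ⊆ Q` (`-1 ≤ lo`, `hi ≤ 0`, `U ⊆ 𝒞`), the velocity has a
representative `V` on `S` with `(V, q)` a "sufficiently smooth axially symmetric solution" on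
`S` in the sense of Seregin–Zajaczkowski 2007 (the class on which the tree proves (2.2)–(2.4)).
Specialisation of `exists_isSmoothAxisymmetricSolutionOn_of_offAxis`; the energy, gradient and
pressure-symmetry hypotheses of (H) are carried but not used.
[cite: Seregin2020, proof of Thm 2.1] -/
theorem exists_isSmoothAxisymmetricSolutionOn_offAxis :
    ∀ (u : ℝ → EuclideanSpace ℝ (Fin 3) → EuclideanSpace ℝ (Fin 3))
      (p : ℝ → EuclideanSpace ℝ (Fin 3) → ℝ)
      (G : ℝ → EuclideanSpace ℝ (Fin 3) → EuclideanSpace ℝ (Fin 3) →L[ℝ] EuclideanSpace ℝ (Fin 3)),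
      IsSuitableWeakSolutionOn (SereginSverak2009.parCylOpens 0 1) 1 0 u p →
      (∃ C : ℝ≥0, ∀ᵐ t ∂(volume.restrict (Ioo (-1 : ℝ) 0)),
        ∫⁻ x in SereginSverak2009.spaceCyl 0 1, ‖u t x‖ₑ ^ 2 ≤ C) →
      HasWeakSpatialGradientOn (SereginSverak2009.parCylOpens 0 1) u G →
      (∫⁻ z in SereginSverak2009.parCyl 0 1, ENNReal.ofReal (frobeniusNormSq (G z.1 z.2)) < ∞) →
      (∫⁻ z in SereginSverak2009.parCyl 0 1, ‖p z.1 z.2‖ₑ ^ (3 / 2 : ℝ) < ∞) →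
      (∀ t ∈ Ioo (-1 : ℝ) 0, IsAxisymmetric (u t)) →
      (∀ t ∈ Ioo (-1 : ℝ) 0, IsAxisymmetricScalar (p t)) →
      ∀ (lo hi : ℝ), -1 ≤ lo → hi ≤ 0 → ∀ (U : Set (EuclideanSpace ℝ (Fin 3))), IsOpen U →
        U ⊆ SereginSverak2009.spaceCyl 0 1 → (∀ x ∈ U, cylRadius x ≠ 0) →
        (∀ θ x, rotZ θ x ∈ U ↔ x ∈ U) →
        ∀ (S : TopologicalSpace.Opens (ℝ × EuclideanSpace ℝ (Fin 3))),
          (S : Set (ℝ × EuclideanSpace ℝ (Fin 3))) = Ioo lo hi ×ˢ U →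
          ∃ V : ℝ → EuclideanSpace ℝ (Fin 3) → EuclideanSpace ℝ (Fin 3),
            SereginZajaczkowski2007.IsSmoothAxisymmetricSolutionOn S V p ∧
              uncurry u =ᵐ[volume.restrict (S : Set (ℝ × EuclideanSpace ℝ (Fin 3)))] uncurry V := by
  intro u p G hsw _hA _hG _hE _hp hu_ax _hp_ax lo hi hlo hhi U _hUo hUQ hUax hUrot S hS
  have hmem : ∀ {z : ℝ × EuclideanSpace ℝ (Fin 3)},
      z ∈ (S : Set (ℝ × EuclideanSpace ℝ (Fin 3))) ↔ z.1 ∈ Ioo lo hi ∧ z.2 ∈ U := by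
    intro z
    rw [hS, mem_prod]
  -- `S ⊆ Q`
  have hSQ : S ≤ SereginSverak2009.parCylOpens 0 1 := by
    intro z hz
    obtain ⟨ht, hx⟩ := hmem.1 hz
    show z.1 ∈ Ioo ((0 : ℝ × EuclideanSpace ℝ (Fin 3)).1 - 1 ^ 2) (0 : ℝ × EuclideanSpace ℝ (Fin 3)).1 ∧
      z.2 ∈ SereginSverak2009.spaceCyl (0 : ℝ × EuclideanSpace ℝ (Fin 3)).2 1
    refine ⟨⟨?_, ?_⟩, hUQ hx⟩
    · simp only [Prod.fst_zero]
      linarith [ht.1]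
    · simp only [Prod.fst_zero]
      linarith [ht.2]
  -- slices are axisymmetric at the times of `Q`
  have hax : ∀ z ∈ ((SereginSverak2009.parCylOpens 0 1 : Opens (ℝ × EuclideanSpace ℝ (Fin 3))) :
      Set (ℝ × EuclideanSpace ℝ (Fin 3))), IsAxisymmetric (u z.1) := by
    intro z hz
    rw [SereginSverak2009.coe_parCylOpens, SereginSverak2009.mem_parCyl_zero] at hz
    refine hu_ax z.1 ⟨?_, hz.1.2⟩
    have := hz.1.1
    norm_num at this
    exact this
  -- `S` is off the axis and rotation invariant
  have hSax : ∀ z ∈ (S : Set (ℝ × EuclideanSpace ℝ (Fin 3))), cylRadius z.2 ≠ 0 :=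
    fun z hz => hUax z.2 (hmem.1 hz).2
  have hSrot : ∀ θ : ℝ, ∀ z ∈ (S : Set (ℝ × EuclideanSpace ℝ (Fin 3))),
      ((z.1, rotZ θ z.2) : ℝ × EuclideanSpace ℝ (Fin 3)) ∈ (S : Set (ℝ × EuclideanSpace ℝ (Fin 3))) := by
    intro θ z hz
    obtain ⟨ht, hx⟩ := hmem.1 hz
    exact hmem.2 ⟨ht, (hUrot θ z.2).2 hx⟩
  exact exists_isSmoothAxisymmetricSolutionOn_of_offAxis hsw hax hSQ hSax hSrot

/-! ### The form for the blow-up limit -/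

/-- **The off-axis smooth representative for the blow-up limit** (Seregin 2020, proof of Thm 2.1,
property (𝒜) and the paragraph before (2.11): "`u` and `p` is axially symmetric solution … in
`Q₋`", smooth off its singular set `S^Γ ⊂ {x' = 0}`): if `(w, π)` is a suitable weak solution in
Albritton–Barker's class on `Q(a) = ]-a², 0[ × B(0, a)` and every slice `w s` is axisymmetric, then
on every open, off-axis, rotation invariant `S ⊆ Q(a)` the field `w` has a representative `V` with
`(V, π)` in the Seregin–Zajaczkowski class on `S`. [cite: Seregin2020, proof of Thm 2.1] -/
theorem exists_isSmoothAxisymmetricSolutionOn_offAxis_of_inBall {a : ℝ}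
    {w : ℝ → EuclideanSpace ℝ (Fin 3) → EuclideanSpace ℝ (Fin 3)}
    {π : ℝ → EuclideanSpace ℝ (Fin 3) → ℝ}
    (hw : IsSuitableWeakSolutionInBall a 0 w π) (hax : ∀ s, IsAxisymmetric (w s))
    {S : Opens (ℝ × EuclideanSpace ℝ (Fin 3))}
    (hSQ : S ≤ parabolicCylinderOpens a (0 : ℝ × EuclideanSpace ℝ (Fin 3)))
    (hSax : ∀ z ∈ (S : Set (ℝ × EuclideanSpace ℝ (Fin 3))), cylRadius z.2 ≠ 0)
    (hSrot : ∀ θ : ℝ, ∀ z ∈ (S : Set (ℝ × EuclideanSpace ℝ (Fin 3))),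
      ((z.1, rotZ θ z.2) : ℝ × EuclideanSpace ℝ (Fin 3)) ∈ (S : Set (ℝ × EuclideanSpace ℝ (Fin 3)))) :
    ∃ V : ℝ → EuclideanSpace ℝ (Fin 3) → EuclideanSpace ℝ (Fin 3),
      IsSmoothAxisymmetricSolutionOn S V π ∧
        uncurry w =ᵐ[volume.restrict (S : Set (ℝ × EuclideanSpace ℝ (Fin 3)))] uncurry V :=
  exists_isSmoothAxisymmetricSolutionOn_of_offAxis hw.1 (fun z _ => hax z.1) hSQ hSax hSrot

/-! ### The registered sub-stub -/

/-- **Sub-stub `stub_seregin2020TypeII_offAxisRepr` of the crux `AxisymmetricKatoGlobal`**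
(toward `stub_seregin2020TypeII`, Seregin 2020 Thm 2.1, the off-axis smooth representative (M0)):
the generic theorem, the form for the hypotheses (H) of Thm 2.1 and the form for the blow-up
limit, conjoined. [cite: Seregin2020, proof of Thm 2.1] -/
theorem stub_seregin2020TypeII_offAxisRepr :
    (∀ (Q S : TopologicalSpace.Opens (ℝ × EuclideanSpace ℝ (Fin 3)))
      (u : ℝ → EuclideanSpace ℝ (Fin 3) → EuclideanSpace ℝ (Fin 3))
      (p : ℝ → EuclideanSpace ℝ (Fin 3) → ℝ),
      IsSuitableWeakSolutionOn Q 1 0 u p →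
      (∀ z ∈ (Q : Set (ℝ × EuclideanSpace ℝ (Fin 3))), IsAxisymmetric (u z.1)) →
      S ≤ Q →
      (∀ z ∈ (S : Set (ℝ × EuclideanSpace ℝ (Fin 3))), cylRadius z.2 ≠ 0) →
      (∀ θ : ℝ, ∀ z ∈ (S : Set (ℝ × EuclideanSpace ℝ (Fin 3))),
        ((z.1, rotZ θ z.2) : ℝ × EuclideanSpace ℝ (Fin 3)) ∈ (S : Set (ℝ × EuclideanSpace ℝ (Fin 3)))) →
      ∃ V : ℝ → EuclideanSpace ℝ (Fin 3) → EuclideanSpace ℝ (Fin 3),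
        SereginZajaczkowski2007.IsSmoothAxisymmetricSolutionOn S V p ∧
          uncurry u =ᵐ[volume.restrict (S : Set (ℝ × EuclideanSpace ℝ (Fin 3)))] uncurry V) ∧
    (∀ (u : ℝ → EuclideanSpace ℝ (Fin 3) → EuclideanSpace ℝ (Fin 3))
      (p : ℝ → EuclideanSpace ℝ (Fin 3) → ℝ)
      (G : ℝ → EuclideanSpace ℝ (Fin 3) → EuclideanSpace ℝ (Fin 3) →L[ℝ] EuclideanSpace ℝ (Fin 3)),
      IsSuitableWeakSolutionOn (SereginSverak2009.parCylOpens 0 1) 1 0 u p →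
      (∃ C : ℝ≥0, ∀ᵐ t ∂(volume.restrict (Ioo (-1 : ℝ) 0)),
        ∫⁻ x in SereginSverak2009.spaceCyl 0 1, ‖u t x‖ₑ ^ 2 ≤ C) →
      HasWeakSpatialGradientOn (SereginSverak2009.parCylOpens 0 1) u G →
      (∫⁻ z in SereginSverak2009.parCyl 0 1, ENNReal.ofReal (frobeniusNormSq (G z.1 z.2)) < ∞) →
      (∫⁻ z in SereginSverak2009.parCyl 0 1, ‖p z.1 z.2‖ₑ ^ (3 / 2 : ℝ) < ∞) →
      (∀ t ∈ Ioo (-1 : ℝ) 0, IsAxisymmetric (u t)) →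
      (∀ t ∈ Ioo (-1 : ℝ) 0, IsAxisymmetricScalar (p t)) →
      ∀ (lo hi : ℝ), -1 ≤ lo → hi ≤ 0 → ∀ (U : Set (EuclideanSpace ℝ (Fin 3))), IsOpen U →
        U ⊆ SereginSverak2009.spaceCyl 0 1 → (∀ x ∈ U, cylRadius x ≠ 0) →
        (∀ θ x, rotZ θ x ∈ U ↔ x ∈ U) →
        ∀ (S : TopologicalSpace.Opens (ℝ × EuclideanSpace ℝ (Fin 3))),
          (S : Set (ℝ × EuclideanSpace ℝ (Fin 3))) = Ioo lo hi ×ˢ U →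
          ∃ V : ℝ → EuclideanSpace ℝ (Fin 3) → EuclideanSpace ℝ (Fin 3),
            SereginZajaczkowski2007.IsSmoothAxisymmetricSolutionOn S V p ∧
              uncurry u =ᵐ[volume.restrict (S : Set (ℝ × EuclideanSpace ℝ (Fin 3)))] uncurry V) ∧
    (∀ (a : ℝ) (w : ℝ → EuclideanSpace ℝ (Fin 3) → EuclideanSpace ℝ (Fin 3))
      (π : ℝ → EuclideanSpace ℝ (Fin 3) → ℝ)
      (S : TopologicalSpace.Opens (ℝ × EuclideanSpace ℝ (Fin 3))),
      IsSuitableWeakSolutionInBall a 0 w π → (∀ s, IsAxisymmetric (w s)) →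
      S ≤ parabolicCylinderOpens a (0 : ℝ × EuclideanSpace ℝ (Fin 3)) →
      (∀ z ∈ (S : Set (ℝ × EuclideanSpace ℝ (Fin 3))), cylRadius z.2 ≠ 0) →
      (∀ θ : ℝ, ∀ z ∈ (S : Set (ℝ × EuclideanSpace ℝ (Fin 3))),
        ((z.1, rotZ θ z.2) : ℝ × EuclideanSpace ℝ (Fin 3)) ∈ (S : Set (ℝ × EuclideanSpace ℝ (Fin 3)))) →
      ∃ V : ℝ → EuclideanSpace ℝ (Fin 3) → EuclideanSpace ℝ (Fin 3),
        SereginZajaczkowski2007.IsSmoothAxisymmetricSolutionOn S V π ∧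
          uncurry w =ᵐ[volume.restrict (S : Set (ℝ × EuclideanSpace ℝ (Fin 3)))] uncurry V) :=
  ⟨fun _ _ _ _ hsw hax hSQ hSax hSrot =>
      exists_isSmoothAxisymmetricSolutionOn_of_offAxis hsw hax hSQ hSax hSrot,
    exists_isSmoothAxisymmetricSolutionOn_offAxis,
    fun _ _ _ _ hw hax hSQ hSax hSrot =>
      exists_isSmoothAxisymmetricSolutionOn_offAxis_of_inBall hw hax hSQ hSax hSrot⟩

end Summit.NavierStokesRegularity.NavierStokesRegularity.Theorems.AxisymmetricKatoGlobal.EulerScaling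

end
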